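import Literature.AnabelianGeometry.AbsoluteAnabelian.AbsTopIII.ReconstructionCor110iProofs
import Literature.AnabelianGeometry.AbsoluteAnabelian.AbsTopIII.ReconstructionCor110iUnivProofs
import Literature.AnabelianGeometry.AbsoluteAnabelian.MLFUnitGroupOfGaloisGroup
import Literature.FieldTheory.AlgClosed.PadicAlgClEquivComplex
import Mathlib.Algebra.Ring.ULift
import HarnessLib

/-!
# [AbsTopIII] Cor. 1.10 (ii)(d), group-theoretic content: `k^×` is reconstructed from `G_k` —
# a FUNCTORIAL witness algorithm and the named fact `AbsTopIII.Cor_1_10_ii` (every universe `u`)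

Mochizuki, *Topics in Absolute Anabelian Geometry III*, §1 Cor. 1.10 (ii)(d) p. 42 (manuscript
pagination, lit key `paper:url-5493eb38cbb7`): «One constructs the image of the Kummer map
`k^× ↪ H¹(G_k, μ_Ẑ(Π_X)) ↪ H¹(Π_X, μ_Ẑ(Π_X))`» — typed by abc-iut-L4-t1 (`Reconstruction.lean`) as
`AbsTopIII.Cor_1_10_ii M`: some `MLFReconstructionAlgorithm` reconstructs the unit GROUP `k^×`, i.e.
`Nonempty ((A.obj (M.ext X)).kummerBase.range ≃* (M.base X)ˣ)` for every curve `X` of `M` over an MLF.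

CONTENT.  The group theory is [AbsAnab] Prop. 1.2.1 (iii): `G_{K₁} ≃ G_{K₂} ⟹ K₁^× ≃ K₂^×`
(`nonempty_units_mulEquiv_of_galoisEquiv`, `MLFUnitGroupOfGaloisGroup.lean`, local fields in `Type`).
The WORK here is the functorial packaging demanded by the signature `MLFReconstructionAlgorithm`
(transport `map` along isomorphisms of extensions with `map_id`/`map_comp`, contravariant `comap` of
function fields along open injective homomorphisms): the reconstructed base field must VARY with the
input extension `E` and yet be functorial.  Construction (at an ARBITRARY universe `u`; revision 2 of
this file — revision 1, abc-iut-L4-d3, was the same construction at universe `0`):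

* `galSetoid` / `GalClass` — extensions `E : FundamentalExtension.{u}` modulo `E.gal ≃ₜ* F.gal`; every
  datum is chosen per CLASS (on `Quotient.out`), so that isomorphic inputs get LITERALLY the same output
  and `map` is transport along an equality of classes (`ClassData.castRingEquiv`, functorial by `subst`);
* `classData q` — for a class `q` whose representative's Galois group is `≃ₜ* Gal(F̄/F)` for some
  characteristic-`0` non-archimedean local field `F : Type` (predicate `Good q`; the local field is
  deliberately kept in `Type`, where the local class field theory inputs are proved), a CHOSEN such `F`
  together with an embedding `F →+* ℂ` (`nonempty_ringHom_complex`: `F ↪ ℚ̄_p ≅ ℂ`, the tree's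
  `PadicAlgCl.nonempty_ringEquiv_complex`); otherwise `ℚ ⊆ ℂ`;
* `algorithm` — base field `:= ULift.{u} (classData ⟦E⟧).F`, Kummer container `H1 := (ULift F)^×` with
  `kummerBase := id`, function field `:= ULift.{u} ℂ` (a universal recipient, so that `comap := id`
  exists along EVERY open injective homomorphism), `frobQuot :=` the characteristic Frobenius quotient
  of `exists_frobQuot_of_extension_univ` (`ReconstructionCor110iUnivProofs.lean`; so the SAME algorithm
  also witnesses Cor. 1.10 (i)(b), `cor_1_10_i_of_algorithm`), cyclotomes and closed-point decomposition
  groups PLACEHOLDERS.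
* `cor_1_10_ii_holds : ∀ M : CurveModel.{u}, AbsTopIII.Cor_1_10_ii M` — for `X` over an MLF
  `k : Type u`: `k` is `Small.{0}` (`IsMLF.small`) and its copy `F₀ := Shrink.{0} k` is a `Type`-local
  field with `(M.ext X).gal ≃ₜ* Gal(F̄₀/F₀)` (`M.galIso X` and `absGalCongrₜ`) and `F₀ ≃+* k`
  (`exists_localField_ringEquiv_of_isMLF`); so `⟦M.ext X⟧` is `Good`, the chosen `F` has
  `Gal(F̄/F) ≃ₜ* Gal(F̄₀/F₀)`, whence `(ULift F)^× ≃* F^× ≃* F₀^× ≃* k^×` by Prop. 1.2.1 (iii);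
  closed form `cor_1_10_ii_forall`.

HONEST SCOPE.  (1) The typed Prop demands no invariance of `kummerBase` under `Aut(G)`; the
reconstruction is «up to a choice per isomorphism class of `G`» — exactly as strong as
Prop. 1.2.1 (iii) allows (`G_k` does NOT determine `k`, [AbsAnab] §1 / [NSW]); a witness ignoring
the group could not be consistent across two models sharing `E` with bases `k`, `k'` unless
`k^× ≃ k'^×`, which is what Prop. 1.2.1 (iii) supplies.  (2) The cyclotomes (a)(c), the container
`H¹(Π_X, μ_Ẑ(Π_X))` as COHOMOLOGY, `K_X` and (e) are NOT reconstructed here (placeholders /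
the universal field `ℂ`): F-1387 / F-0347 / F-0396 stay with their holders.  (3) The local class field
theory inputs (`galoisMLF_iso_unitImage_holds`, reciprocity) are used at `Type` only; the universe `u`
of the model is reached through `Shrink.{0}` / `ULift.{u}` and the universe-polymorphic transport
`absGalCongrₜ` — no input is restated.  TODO (strengthened statement owed, L4-lead RULING #5g (2)):
`Cor_1_10_ii'` over the REAL container `galCyclotomeH1`, see the section comment below.
abc-iut-L4-d3 lineage (revision 1, universe `0`; support for the F-0395 row held by abc-iut-L4-d2),
abc-iut-w5-d036 (revision 2: universe `u`, in place, per the review of p428477); classical local class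
field theory; nothing here bears on [IUTchIII] Cor. 3.12 or takes a side.
-/

noncomputable section

open CategoryTheory Function
open ProfiniteGrp ProfiniteGrp.ProfiniteCompletion Topology

universe u

namespace Literature.AnabelianGeometry.AbsoluteAnabelian

open Field ValuativeRel
open Literature.NumberTheory.GaloisRepresentations
open Literature.NumberTheory.GaloisRepresentations.IsNonarchimedeanLocalField

namespace AbsTopIII

namespace Cor110ii

/-! ### Every MLF embeds into `ℂ` -/

/-- A characteristic-`0` non-archimedean local field embeds (as a field) into `ℂ`: `F` is a finite,
hence algebraic, extension of `ℚ_p` (`p` the residue characteristic), so `F ↪ ℚ̄_p`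
(`IsAlgClosed.lift`), and `ℚ̄_p ≅ ℂ` abstractly (`PadicAlgCl.nonempty_ringEquiv_complex`).
[cite: MochizukiAbsTopIII2015, Cor 1.10 (ii) p.42] -/
theorem nonempty_ringHom_complex (F : Type) [Field F] [ValuativeRel F] [TopologicalSpace F]
    [IsNonarchimedeanLocalField F] [CharZero F] : Nonempty (F →+* ℂ) := by
  obtain ⟨hp, hv⟩ := prime_ringChar_residueField_and_valuation_lt_one (K := F)
  haveI : Fact (ringChar 𝓀[F]).Prime := ⟨hp⟩
  letI := LocalField.padicAlgebra F (ringChar 𝓀[F]) hv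
  haveI : FiniteDimensional ℚ_[ringChar 𝓀[F]] F :=
    Literature.NumberTheory.PAdicHodge.PadicBase.instFiniteDimensional (F := F) hv
  obtain ⟨ψ⟩ := PadicAlgCl.nonempty_ringEquiv_complex (ringChar 𝓀[F])
  let ι : F →ₐ[ℚ_[ringChar 𝓀[F]]] PadicAlgCl (ringChar 𝓀[F]) := IsAlgClosed.lift
  exact ⟨ψ.toRingHom.comp ι.toRingHom⟩

/-! ### Extensions (any universe) modulo isomorphism of their Galois groups -/

/-- Extensions `E`, `F` (universe `u`) are equivalent when `E.gal ≃ₜ* F.gal`.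
[cite: MochizukiAbsTopIII2015, Cor 1.10 p.44] -/
def galSetoid : Setoid FundamentalExtension.{u} where
  r E F := Nonempty (E.gal ≃ₜ* F.gal)
  iseqv := ⟨fun _ => ⟨ContinuousMulEquiv.refl _⟩, fun ⟨e⟩ => ⟨e.symm⟩, fun ⟨e⟩ ⟨f⟩ => ⟨e.trans f⟩⟩

/-- Classes of extensions modulo `E.gal ≃ₜ* F.gal`. [cite: MochizukiAbsTopIII2015, Cor 1.10 p.44] -/
def GalClass : Type (u + 1) := Quotient galSetoid.{u}

/-- The class of an extension. [cite: MochizukiAbsTopIII2015, Cor 1.10 p.44] -/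
def classOf (E : FundamentalExtension.{u}) : GalClass.{u} := Quotient.mk galSetoid E

/-- An isomorphism of extensions gives a topological isomorphism of the Galois groups.
[cite: MochizukiAbsTopIII2015, Cor 1.10 p.44] -/
theorem nonempty_galEquiv_of_iso {E F : FundamentalExtension.{u}} (e : E ≅ F) :
    Nonempty (E.gal ≃ₜ* F.gal) := by
  refine ⟨{ toFun := e.hom.gal
            invFun := e.inv.gal
            left_inv := fun x => ?_
            right_inv := fun y => ?_
            map_mul' := map_mul e.hom.gal
            continuous_toFun := e.hom.gal.continuous
            continuous_invFun := e.inv.gal.continuous }⟩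
  · have h := congrArg (fun f : E ⟶ E => f.gal x) e.hom_inv_id
    exact h
  · have h := congrArg (fun f : F ⟶ F => f.gal y) e.inv_hom_id
    exact h

/-- Isomorphic extensions have the same class. [cite: MochizukiAbsTopIII2015, Cor 1.10 p.44] -/
theorem classOf_eq_of_iso {E F : FundamentalExtension.{u}} (e : E ≅ F) : classOf E = classOf F :=
  Quotient.sound (nonempty_galEquiv_of_iso e)

/-- The representative of the class of `E` has Galois group `≃ₜ* E.gal`.
[cite: MochizukiAbsTopIII2015, Cor 1.10 p.44] -/
theorem nonempty_out_galEquiv (E : FundamentalExtension.{u}) :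
    Nonempty ((Quotient.out (classOf E)).gal ≃ₜ* E.gal) :=
  Quotient.mk_out (s := galSetoid) E

/-- A class is *good* when its representative's Galois group is that of a characteristic-`0`
non-archimedean local field `F : Type` (up to `≃ₜ*`; the local field is deliberately taken in
`Type`, where the local class field theory inputs are proved).
[cite: MochizukiAbsTopIII2015, Cor 1.10 p.41] -/
def Good (q : GalClass.{u}) : Prop :=
  ∃ (F : Type) (_ : Field F) (_ : ValuativeRel F) (_ : TopologicalSpace F)
    (_ : IsNonarchimedeanLocalField F) (_ : CharZero F),
    Nonempty ((Quotient.out q).gal ≃ₜ* absoluteGaloisGroup F)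

/-- The data chosen per class: a field `F ⊆ ℂ` in `Type` (an embedding), which — for a good class —
is a characteristic-`0` non-archimedean local field whose absolute Galois group is that of the
class. [cite: MochizukiAbsTopIII2015, Cor 1.10 (ii) p.42] -/
structure ClassData (q : GalClass.{u}) : Type 1 where
  /-- the reconstructed base field (in `Type`; lifted to `Type u` by `ULift` in the algorithm) -/
  F : Type
  /-- its field structure -/
  [fld : Field F]
  /-- an embedding into the universal function field `ℂ` -/
  emb : F →+* ℂ
  /-- for a good class, `F` is a local field with the right Galois group -/
  spec : Good q → ∃ (_ : ValuativeRel F) (_ : TopologicalSpace F) (_ : IsNonarchimedeanLocalField F)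
    (_ : CharZero F), Nonempty ((Quotient.out q).gal ≃ₜ* absoluteGaloisGroup F)

attribute [instance] ClassData.fld

/-- The CHOICE of the data of a class (local field + embedding into `ℂ` for a good class, `ℚ ⊆ ℂ`
otherwise). [cite: MochizukiAbsTopIII2015, Cor 1.10 (ii) p.42] -/
def classData (q : GalClass.{u}) : ClassData q := by
  classical
  exact if h : Good q then
    @ClassData.mk q h.choose h.choose_spec.choose
      (by
        letI := h.choose_spec.choose
        letI := h.choose_spec.choose_spec.choose
        letI := h.choose_spec.choose_spec.choose_spec.choose
        haveI := h.choose_spec.choose_spec.choose_spec.choose_spec.choose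
        haveI := h.choose_spec.choose_spec.choose_spec.choose_spec.choose_spec.choose
        exact Classical.choice (nonempty_ringHom_complex h.choose))
      (fun _ => h.choose_spec.choose_spec)
  else @ClassData.mk q ℚ inferInstance (algebraMap ℚ ℂ) (fun h' => (h h').elim)

/-- Transport of the (lifted) reconstructed base field along an EQUALITY of classes (the
functoriality of the witness algorithm in isomorphisms of extensions).
[cite: MochizukiAbsTopIII2015, Cor 1.10 p.44] -/
def ClassData.castRingEquiv {q₁ q₂ : GalClass.{u}} (h : q₁ = q₂) :
    ULift.{u} (classData q₁).F ≃+* ULift.{u} (classData q₂).F := by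
  subst h
  exact RingEquiv.refl _

/-- The transport is compatible with the embeddings into `ℂ` (on the underlying `Type`-level
elements). [cite: MochizukiAbsTopIII2015, Cor 1.10 p.44] -/
theorem ClassData.emb_castRingEquiv {q₁ q₂ : GalClass.{u}} (h : q₁ = q₂) (c : ULift.{u} (classData q₁).F) :
    (classData q₂).emb (ClassData.castRingEquiv h c).down = (classData q₁).emb c.down := by
  subst h
  rfl

/-- The embedding of the lifted base field `ULift F` into the lifted function field `ULift ℂ`.
[cite: MochizukiAbsTopIII2015, Cor 1.10 (ii) p.42] -/
def ClassData.embLift (q : GalClass.{u}) : ULift.{u} (classData q).F →+* ULift.{u} ℂ :=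
  (ULift.ringEquiv.symm : ℂ ≃+* ULift.{u} ℂ).toRingHom.comp
    ((classData q).emb.comp (ULift.ringEquiv : ULift.{u} (classData q).F ≃+* (classData q).F).toRingHom)

/-- The transport is compatible with the embeddings into `ULift ℂ`.
[cite: MochizukiAbsTopIII2015, Cor 1.10 p.44] -/
theorem ClassData.embLift_castRingEquiv {q₁ q₂ : GalClass.{u}} (h : q₁ = q₂)
    (c : ULift.{u} (classData q₁).F) :
    ClassData.embLift q₂ (ClassData.castRingEquiv h c) = ClassData.embLift q₁ c := by
  subst h
  rfl

/-! ### The witness algorithm -/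

/-- The output of the witness algorithm on an abstract extension `E : FundamentalExtension.{u}`: base
field `ULift (classData ⟦E⟧).F` with its embedding into the function field `ULift ℂ`, Kummer container
`(ULift F)^×` with `kummerBase := id`, Frobenius quotient from `exists_frobQuot_of_extension_univ`;
cyclotomes and decomposition groups are PLACEHOLDERS. [cite: MochizukiAbsTopIII2015, Cor 1.10 (ii) p.42] -/
def obj (E : FundamentalExtension.{u}) : MLFReconstruction E :=
  { galCyclotome := PUnit
    arithCyclotome := PUnit
    cycloSync := AddEquiv.refl PUnit
    frobQuot := (exists_frobQuot_of_extension_univ E).choose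
    H1 := (ULift.{u} (classData (classOf E)).F)ˣ
    baseField := ULift.{u} (classData (classOf E)).F
    kummerBase := MonoidHom.id _
    kummerBase_injective := fun _ _ h => h
    functionField := ULift.{u} ℂ
    instAlgebra := (ClassData.embLift (classOf E)).toAlgebra
    closedPointDecomp := ∅ }

/-- **The witness `MLFReconstructionAlgorithm` at universe `u`** for Cor. 1.10 (i)(b) and (ii)(d)
simultaneously: functorial in isomorphisms of extensions by transport along equality of classes;
`comap := id`. [cite: MochizukiAbsTopIII2015, Cor 1.10 p.41] -/
def algorithm : MLFReconstructionAlgorithm.{u} where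
  obj := obj
  map e := ⟨ClassData.castRingEquiv (classOf_eq_of_iso e), RingEquiv.refl (ULift.{u} ℂ),
    fun c => (ClassData.embLift_castRingEquiv (classOf_eq_of_iso e) c).symm⟩
  map_id _ := rfl
  map_comp _ _ := rfl
  comap _ _ := RingHom.id (ULift.{u} ℂ)
  comap_map _ _ _ := rfl

/-- The algorithm's Kummer map is the identity of `(ULift F)^×` (unfolding).
[cite: MochizukiAbsTopIII2015, Cor 1.10 (ii) p.42] -/
theorem algorithm_kummerBase (E : FundamentalExtension.{u}) :
    (algorithm.obj E).kummerBase = MonoidHom.id (ULift.{u} (classData (classOf E)).F)ˣ := rfl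

/-- The algorithm's Frobenius quotient is the one of `exists_frobQuot_of_extension_univ` (unfolding).
[cite: MochizukiAbsTopIII2015, Cor 1.10 (i) p.42] -/
theorem algorithm_frobQuot (E : FundamentalExtension.{u}) :
    (algorithm.obj E).frobQuot = (exists_frobQuot_of_extension_univ E).choose := rfl

/-! ### Curves over MLF's give good classes -/

/-- For a curve `X` of a model over an MLF `k`, the class of `M.ext X` is good and its Galois group is
`≃ₜ* Gal(k̄/k)` for the valued structure of `k` as a finite extension of `ℚ_p` (any universe: the
tree's finite-extension local-field package is universe-polymorphic).
[cite: MochizukiAbsTopIII2015, Cor 1.10 p.41] -/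
theorem exists_localField_of_isMLF (M : CurveModel.{u}) (X : M.Curve) (hX : IsMLF (M.base X)) :
    ∃ (_ : ValuativeRel (M.base X)) (_ : TopologicalSpace (M.base X))
      (_ : IsNonarchimedeanLocalField (M.base X)),
      Nonempty ((M.ext X).gal ≃ₜ* absoluteGaloisGroup (M.base X)) := by
  obtain ⟨p, hp, φ, hfin⟩ := hX.exists_padic
  letI : Algebra ℚ_[p] (M.base X) := φ.toAlgebra
  haveI : Module.Finite ℚ_[p] (M.base X) := hfin
  haveI : IsNonarchimedeanLocalField ℚ_[p] := Padic.isNonarchimedeanLocalField_holds p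
  letI := FiniteExtension.normedField ℚ_[p] (M.base X)
  letI := FiniteExtension.valuativeRel ℚ_[p] (M.base X)
  haveI : IsNonarchimedeanLocalField (M.base X) :=
    FiniteExtension.isNonarchimedeanLocalField ℚ_[p] (M.base X)
  exact ⟨inferInstance, inferInstance, inferInstance, nonempty_continuousMulEquiv_of_iso (M.galIso X)⟩

/-- For a curve `X` of a model `M : CurveModel.{u}` over an MLF `k : Type u`, there is a
characteristic-`0` non-archimedean local field `F₀ : Type` with `(M.ext X).gal ≃ₜ* Gal(F̄₀/F₀)` AND
`F₀ ≃+* k` — namely `F₀ := Shrink.{0} k` (`IsMLF.small`, `IsMLF.shrink`), with the valued structure of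
a finite extension of `ℚ_p`, through `M.galIso X` and `absGalCongrₜ`.
[cite: MochizukiAbsTopIII2015, Cor 1.10 p.41] -/
theorem exists_localField_ringEquiv_of_isMLF (M : CurveModel.{u}) (X : M.Curve)
    (hX : IsMLF (M.base X)) :
    ∃ (F : Type) (_ : Field F) (_ : ValuativeRel F) (_ : TopologicalSpace F)
      (_ : IsNonarchimedeanLocalField F) (_ : CharZero F),
      Nonempty ((M.ext X).gal ≃ₜ* absoluteGaloisGroup F) ∧ Nonempty (F ≃+* M.base X) := by
  haveI : Small.{0} (M.base X) := hX.small
  have hF : IsMLF (Shrink.{0} (M.base X)) := hX.shrink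
  obtain ⟨p, hp, φ, hfin⟩ := hF.exists_padic
  letI : Algebra ℚ_[p] (Shrink.{0} (M.base X)) := φ.toAlgebra
  haveI : Module.Finite ℚ_[p] (Shrink.{0} (M.base X)) := hfin
  haveI : IsNonarchimedeanLocalField ℚ_[p] := Padic.isNonarchimedeanLocalField_holds p
  letI := FiniteExtension.normedField ℚ_[p] (Shrink.{0} (M.base X))
  letI := FiniteExtension.valuativeRel ℚ_[p] (Shrink.{0} (M.base X))
  haveI : IsNonarchimedeanLocalField (Shrink.{0} (M.base X)) :=
    FiniteExtension.isNonarchimedeanLocalField ℚ_[p] (Shrink.{0} (M.base X))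
  haveI : CharZero (Shrink.{0} (M.base X)) :=
    charZero_of_injective_algebraMap (algebraMap ℚ_[p] (Shrink.{0} (M.base X))).injective
  obtain ⟨e₀⟩ := nonempty_continuousMulEquiv_of_iso (M.galIso X)
  exact ⟨Shrink.{0} (M.base X), inferInstance, inferInstance, inferInstance, inferInstance,
    inferInstance, ⟨e₀.trans (absGalCongrₜ (Shrink.ringEquiv (M.base X)).symm)⟩,
    ⟨Shrink.ringEquiv (M.base X)⟩⟩

/-- The class of `M.ext X` is good for `X` over an MLF (any universe).
[cite: MochizukiAbsTopIII2015, Cor 1.10 p.41] -/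
theorem good_classOf_of_isMLF (M : CurveModel.{u}) (X : M.Curve) (hX : IsMLF (M.base X)) :
    Good (classOf (M.ext X)) := by
  obtain ⟨F, fF, v, t, lf, cz, ⟨e₀⟩, -⟩ := exists_localField_ringEquiv_of_isMLF M X hX
  obtain ⟨e⟩ := nonempty_out_galEquiv (M.ext X)
  exact ⟨F, fF, v, t, lf, cz, ⟨e.trans e₀⟩⟩

/-! ### The intrinsic form: `k^×` IS the image of the Weil group in `G_k^ab` -/

/-- **Intrinsic (printed) characterisation behind Cor. 1.10 (ii)(d)**: for a characteristic-`0`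
non-archimedean local field `k`, the unit group `k^×` is isomorphic to the image `𝔄_k^0` of the WEIL
GROUP in `G_k^ab` — the classes of FROBENIUS-INTEGRAL degree under `G_k ↠ G^unr ≅ Ẑ` (the quotient
of `exists_frobeniusQuotient_charZHat`, F-0394) — via any reciprocity map (injective with range
`𝔄_k^0`: `IsLocalReciprocityMap.injective` / `.range_eq`, `exists_isLocalReciprocityMap_holds`).  This is
the group-theoretic content «`k^× ⊂ G_k^ab`» that the typed `Cor_1_10_ii` does NOT demand (see the
TODO below). [cite: MochizukiAbsTopIII2015, Cor 1.10 (ii) p.42] -/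
theorem nonempty_units_mulEquiv_weilImage (k : Type) [Field k] [ValuativeRel k] [TopologicalSpace k]
    [IsNonarchimedeanLocalField k] :
    Nonempty (kˣ ≃* (weilSubgroup k).map (absGaloisAbProj k)) := by
  obtain ⟨θ, hθ⟩ := exists_isLocalReciprocityMap_holds k
  exact ⟨(MonoidHom.ofInjective hθ.injective).trans (MulEquiv.subgroupCongr hθ.range_eq)⟩

/-! ### Cor. 1.10 (ii)(d): the named fact, every universe

TODO (strengthened statement owed, L4-lead RULING #5g (2)): `Cor_1_10_ii'` — an algorithm whose
Kummer container is the REAL `H¹(G, μ_Ẑ(G))` (`galCyclotomeH1`) and whose `kummerBase.range` is carried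
to itself by every `ψ : G ≃ₜ* G` and identified with `𝔄_k^0 ⊂ G_k^ab` through F-0347's
`H¹(G_k, μ_Ẑ(G_k)) ≅ G_k^ab`; the present file closes `Cor_1_10_ii` AS TYPED (existence, by a choice
per isomorphism class of `G`), with the intrinsic content recorded as
`nonempty_units_mulEquiv_weilImage` + `nonempty_units_mulEquiv_of_galoisEquiv`. -/

/-- **[AbsTopIII] Cor. 1.10 (ii)(d) — the named fact `Cor_1_10_ii M` HOLDS for every model
`M : CurveModel.{u}`, at every universe `u`**, witnessed by `algorithm`: on a curve `X` over an MLF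
`k`, the reconstructed unit group `(ULift (classData ⟦M.ext X⟧).F)^×` is isomorphic to `k^×`, because
the chosen `Type`-local field `F` has `Gal(F̄/F) ≃ₜ* Gal(F̄₀/F₀)` for the small copy `F₀ ≅ k`, and
«`G_K` determines `K^×`» ([AbsAnab] Prop. 1.2.1 (iii), `nonempty_units_mulEquiv_of_galoisEquiv`, at
`Type`).  Honest scope in the module docstring. [cite: MochizukiAbsTopIII2015, Cor 1.10 (ii) p.42] -/
theorem cor_1_10_ii_holds (M : CurveModel.{u}) :
    Literature.AnabelianGeometry.AbsoluteAnabelian.AbsTopIII.Cor_1_10_ii M := by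
  refine ⟨algorithm, fun X hX => ?_⟩
  -- a `Type`-local field `F₀ ≅ k` with `E.gal ≃ₜ* Γ_{F₀}`
  obtain ⟨F₀, fF₀, v, t, lf, cz, ⟨e₀⟩, ⟨r⟩⟩ := exists_localField_ringEquiv_of_isMLF M X hX
  obtain ⟨e⟩ := nonempty_out_galEquiv (M.ext X)
  -- the chosen local field of the class and `Γ_F ≃ₜ* Γ_{F₀}`
  obtain ⟨vF, tF, lfF, czF, ⟨e₁⟩⟩ :=
    (classData (classOf (M.ext X))).spec (good_classOf_of_isMLF M X hX)
  obtain ⟨eu⟩ := nonempty_units_mulEquiv_of_galoisEquiv (K₁ := (classData (classOf (M.ext X))).F)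
    (K₂ := F₀) (e₁.symm.trans (e.trans e₀))
  refine ⟨(MulEquiv.subgroupCongr ?_).trans (Subgroup.topEquiv.trans
    ((Units.mapEquiv (ULift.ringEquiv :
        ULift.{u} (classData (classOf (M.ext X))).F ≃+* (classData (classOf (M.ext X))).F).toMulEquiv).trans
      (eu.trans (Units.mapEquiv r.toMulEquiv))))⟩
  rw [algorithm_kummerBase]
  exact MonoidHom.range_eq_top.mpr surjective_id

/-- **[AbsTopIII] Cor. 1.10 (ii)(d), closed universe-polymorphic form**: the named fact
`Cor_1_10_ii` (FACT-LIST F-0395) holds for ALL models at universe `u`.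
[cite: MochizukiAbsTopIII2015, Cor 1.10 (ii) p.42] -/
theorem cor_1_10_ii_forall :
    ∀ M : CurveModel.{u}, Literature.AnabelianGeometry.AbsoluteAnabelian.AbsTopIII.Cor_1_10_ii M :=
  cor_1_10_ii_holds

/-- **The SAME universe-`u` algorithm witnesses Cor. 1.10 (i)(b)** (`Cor_1_10_i M`): its Frobenius
quotient is the characteristic one of `exists_frobQuot_of_extension_univ` — surjective and
`Aut(G)`-invariant on every curve over an MLF. [cite: MochizukiAbsTopIII2015, Cor 1.10 (i) p.42] -/
theorem cor_1_10_i_of_algorithm (M : CurveModel.{u}) :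
    ∀ X : M.Curve, M.IsCor110Input X →
      Function.Surjective (algorithm.obj (M.ext X)).frobQuot ∧
        ∀ (φ : (M.ext X).gal ≃ₜ* (M.ext X).gal) (g : (M.ext X).gal),
          (algorithm.obj (M.ext X)).frobQuot (φ g) = (algorithm.obj (M.ext X)).frobQuot g := by
  intro X hX
  rw [algorithm_frobQuot]
  exact (exists_frobQuot_of_extension_univ (M.ext X)).choose_spec
    (CurveModel.exists_localField_gal_of_isMLF_univ M X hX)

/-- **One algorithm for Cor. 1.10 (i)(b) and (ii)(d), every universe**: `algorithm.{u}` witnesses both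
named facts at once on every `M : CurveModel.{u}`. [cite: MochizukiAbsTopIII2015, Cor 1.10 p.42] -/
theorem cor_1_10_i_and_ii_holds (M : CurveModel.{u}) :
    (∀ X : M.Curve, M.IsCor110Input X →
      Function.Surjective (algorithm.obj (M.ext X)).frobQuot ∧
        ∀ (φ : (M.ext X).gal ≃ₜ* (M.ext X).gal) (g : (M.ext X).gal),
          (algorithm.obj (M.ext X)).frobQuot (φ g) = (algorithm.obj (M.ext X)).frobQuot g) ∧
    (∀ X : M.Curve, M.IsCor110Input X →
      Nonempty ((algorithm.obj (M.ext X)).kummerBase.range ≃* (M.base X)ˣ)) := by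
  refine ⟨cor_1_10_i_of_algorithm M, fun X hX => ?_⟩
  obtain ⟨F₀, fF₀, v, t, lf, cz, ⟨e₀⟩, ⟨r⟩⟩ := exists_localField_ringEquiv_of_isMLF M X hX
  obtain ⟨e⟩ := nonempty_out_galEquiv (M.ext X)
  obtain ⟨vF, tF, lfF, czF, ⟨e₁⟩⟩ :=
    (classData (classOf (M.ext X))).spec (good_classOf_of_isMLF M X hX)
  obtain ⟨eu⟩ := nonempty_units_mulEquiv_of_galoisEquiv (K₁ := (classData (classOf (M.ext X))).F)
    (K₂ := F₀) (e₁.symm.trans (e.trans e₀))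
  refine ⟨(MulEquiv.subgroupCongr ?_).trans (Subgroup.topEquiv.trans
    ((Units.mapEquiv (ULift.ringEquiv :
        ULift.{u} (classData (classOf (M.ext X))).F ≃+* (classData (classOf (M.ext X))).F).toMulEquiv).trans
      (eu.trans (Units.mapEquiv r.toMulEquiv))))⟩
  rw [algorithm_kummerBase]
  exact MonoidHom.range_eq_top.mpr surjective_id

end Cor110ii

end AbsTopIII

end Literature.AnabelianGeometry.AbsoluteAnabelian

end
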